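import Summits.QuantumFields.YangMills.Theorems.UnitScaleTiltProp8FlatHDressingShape
import Summits.QuantumFields.YangMills.Theorems.UnitScaleTiltProp8ChartHInvFromFlatOps
import Literature.MathematicalPhysics.QuantumFieldTheory.Balaban1983to89.B9Thm39ReadingCoords
import HarnessLib

/-!
# Route `UnitScaleTilt`, crux K1 «MinimiserStabilityRegPr» (stmt-QuantumFields-19200), stub V2′ `stub_halvingStep` (H), RULING g26-№6 (S5) «H := flatH for the ♭ chart»:
# **THE LEVEL-SCALED ℂ-LINEAR KERNEL EXTENSION OF P2's FLAT `H` — A RIGHT INVERSE OF `η·Lʲ·Q_j` WITH BOTH (46) ROWS AT P2's CONSTANT, UNGUARDED**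

Cell `ym3-torus` (HUMAN RULING D-0037: YM ladder rung R3 — not the Clay problem), width seat `ym-ust-19200-w3` gen 4.  `--supports stmt-QuantumFields-19200 --as helper`;
def-free, 0 sorry.

THE POINT.  Under RULING g26-№6 the chart of record is print's double-bar functional, whose linearisation at `A = 0` is `η·Lʲ·Q_j` on the level-`j` index bonds (NO comb
term; [Balaban1985Variational] (44)–(45), (S1)'s certificate), so the chart's `H` is P2's `H = GQ*(QGQ*)⁻¹` (`FlatOpsLettersAssembly.flatH`, (157)) read on matrix data with
the level factor `(Lʲη)⁻¹` in front: `Hs X (b) := Σ_c (flatH e_c)(b)·(L^{j(c)}η)⁻¹ • X(c)`, `η = L^{−(K−n)}`.  This file builds `Hs` IN-PROOF as a `→ₗ[ℂ]` (no `def`) and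
proves: (i) the RIGHT-INVERSE identity `(L^{j(c)}η) • Q_{j(c)}(Hs X)(c) = X(c)` ((45) `QH = I`: ✓`ChartHInv.bondAvgIter_of_isFlatH` + ✓`ChartHInv.bondAvgIter_kernel_apply`);
(ii) BOTH (46) rows at P2's constant `B₀` EXACTLY (`HSupLetterG`'s level-weighted data hypothesis `(L^{j(c)}η)|Xr c| ≤ t` is met with EQUALITY by the scaled sign data —
the `letter_Y` trick, no tent factors, no slack), UNGUARDED in `t` thanks to lit-balaban's `B9Thm39ReadingCoords.bondIdx_nonempty` (every nested family has an index bond: the greatest nonempty level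
has no deep sites).  Hence the `hH` binders of the dressing consumers (`FlatProp4Dressing.hWq_of_dressing`, ✓p607709) and the `hHinv`∕`hHB` binders of the (X4)∕(S6)
readings hold for ONE explicit `H`, for EVERY nested family `D` with `D.k = K − n` and level weights — no admissibility needed at this stage.

WHAT THIS FILE PROVES (theorems only): §1 (lit-balaban's ✓`B9Thm39ReadingCoords.bondIdx_nonempty`: every nested family has an index bond — discharges p610390's `Nonempty` premiss); §2 `supRow_scaledKernel`∕`gradRow_scaledKernel` (guarded, any real `H₀` with `HSupLetterG`);
§3 ★★★`exists_flatH_scaledExt` — `∃ Hs : (BondIdx D → M₂) →ₗ[ℂ] (PBond (F.P K) 0 → M₂)`, (formula) ∧ (45) ∧ (46)₁ ∧ (46)₂ unguarded; `twoRows_flatH` = `FlatHDressingShape.twoRows_flatH_unguarded`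
with the `Nonempty` premiss discharged.
HONEST SCOPE: bookkeeping over P2's ported letter and identity; nothing of Bałaban's estimates is proved here; NOT a claim about the stub, the crux, the rung or the mass gap.

References: T. Bałaban, CMP **102** (1985) 277–309 [Balaban1985Variational] ((44)–(46) p.285, (157) p.302); CMP **96** (1984) 223–250 [Balaban1984PropagatorsII]
((2.1)–(2.3) p.224, (2.20) p.226, (2.35) p.228, Cor. 2.8 p.249).
-/

set_option autoImplicit false

noncomputable section

open scoped BigOperators Matrix.Norms.L2Operator

namespace Summit.QuantumFields.YangMills.Theorems.FlatHDressingShape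

open Literature.MathematicalPhysics.QuantumFieldTheory.Balaban1983to89
open LatticeFieldCalculus (bondAvgIter)
open B6SectADomainsV1 (Domains)
open B6SectAOperatorsV1 (BondIdx)
open T3ContinuumYM3Torus (T3Family)
open Summit.QuantumFields.YangMills.Theorems.FlatCubeOpsText (IsLevWeight IsFlatH HSupLetterG)
open Summit.QuantumFields.YangMills.Theorems.FlatOpsLettersAssembly (flatH isFlatH_flatH levWeight_nonneg)
open Summit.QuantumFields.YangMills.Theorems.ChartHInv (bondAvgIter_of_isFlatH bondAvgIter_kernel_apply)

/-! ## §1 Every nested family has an index bond: `B9Thm39ReadingCoords.bondIdx_nonempty` (lit-balaban), read here -/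

variable (F : T3Family) (n K : ℕ) (D : Domains (F.P K))

/-- `twoRows_flatH_unguarded` with the `Nonempty` premiss discharged. [cite: Balaban1985Variational, (46) p.285] -/
theorem twoRows_flatH (hDk : D.k ≤ K - n) (w : ℕ → PBond (F.P K) 0 → ℝ) (hw : IsLevWeight F n K D w) {B₀ : ℝ}
    (hsup : HSupLetterG F n K D w (flatH F n K D) B₀) :
    (∀ (X : BondIdx D → Matrix (Fin 2) (Fin 2) ℂ) (t : ℝ), (∀ c, ‖X c‖ ≤ t) → ∀ b, w 1 b * ‖∑ c, flatH F n K D (Pi.single c 1) b • X c‖ ≤ B₀ * t) ∧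
    ∀ (X : BondIdx D → Matrix (Fin 2) (Fin 2) ℂ) (t : ℝ), (∀ c, ‖X c‖ ≤ t) → ∀ (b : PBond (F.P K) 0) (ν : Fin 3),
      w 2 b * (F.L : ℝ) ^ (K - n) * ‖(∑ c, flatH F n K D (Pi.single c 1) ⟨b.src.shift ν, b.dir⟩ • X c) - ∑ c, flatH F n K D (Pi.single c 1) b • X c‖ ≤ B₀ * t :=
  twoRows_flatH_unguarded F n K D hDk w hw hsup (B9Thm39ReadingCoords.bondIdx_nonempty D)

/-! ## §2 The two rows for the level-SCALED kernel, guarded -/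

/-- **THE SUP ROW OF THE SCALED KERNEL EXTENSION** (guarded): for any real `H₀` with `HSupLetterG`, data `‖X c‖ ≤ t`, `0 ≤ t`:
`w 1 b·‖Σ_c ((H₀ e_c)(b)·(L^{j(c)}η)⁻¹) • X c‖ ≤ B₀·t` — the sign data `±(L^{j(c)}η)⁻¹t` has level-weighted size EXACTLY `t`. [cite: Balaban1985Variational, (46) p.285] -/
theorem supRow_scaledKernel (w : ℕ → PBond (F.P K) 0 → ℝ) (hw1 : ∀ b, 0 ≤ w 1 b) (H₀ : (BondIdx D → ℝ) →ₗ[ℝ] (PBond (F.P K) 0 → ℝ))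
    {B₀ : ℝ} (hsup : HSupLetterG F n K D w H₀ B₀) (X : BondIdx D → Matrix (Fin 2) (Fin 2) ℂ) {t : ℝ} (ht : 0 ≤ t) (hX : ∀ c, ‖X c‖ ≤ t)
    (b : PBond (F.P K) 0) :
    w 1 b * ‖∑ c, (H₀ (Pi.single c 1) b * ((F.L : ℝ) ^ (c.1.1 : ℕ) * ((F.L : ℝ)⁻¹) ^ (K - n))⁻¹) • X c‖ ≤ B₀ * t := by
  classical
  have hL0 : (0 : ℝ) < F.L := by exact_mod_cast (F.P K).L_pos
  have hlam : ∀ c : BondIdx D, 0 < (F.L : ℝ) ^ (c.1.1 : ℕ) * ((F.L : ℝ)⁻¹) ^ (K - n) := fun c => by positivity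
  set Kc : BondIdx D → ℝ := fun c => H₀ (Pi.single c 1) b with hKc
  set Xr : BondIdx D → ℝ := fun c => if 0 ≤ Kc c then ((F.L : ℝ) ^ (c.1.1 : ℕ) * ((F.L : ℝ)⁻¹) ^ (K - n))⁻¹ * t
    else -(((F.L : ℝ) ^ (c.1.1 : ℕ) * ((F.L : ℝ)⁻¹) ^ (K - n))⁻¹ * t) with hXr
  have hXr_abs : ∀ c, |Xr c| = ((F.L : ℝ) ^ (c.1.1 : ℕ) * ((F.L : ℝ)⁻¹) ^ (K - n))⁻¹ * t := fun c => by
    have h0 : 0 ≤ ((F.L : ℝ) ^ (c.1.1 : ℕ) * ((F.L : ℝ)⁻¹) ^ (K - n))⁻¹ * t := mul_nonneg (inv_nonneg.2 (hlam c).le) ht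
    simp only [hXr]; split_ifs
    · exact abs_of_nonneg h0
    · rw [abs_neg, abs_of_nonneg h0]
  have hXr_w : ∀ c, ((F.L : ℝ) ^ (c.1.1 : ℕ) * ((F.L : ℝ)⁻¹) ^ (K - n)) * |Xr c| ≤ t := fun c => by
    rw [hXr_abs, ← mul_assoc, mul_inv_cancel₀ (hlam c).ne', one_mul]
  have hKX : ∀ c, Xr c * Kc c = |Kc c| * (((F.L : ℝ) ^ (c.1.1 : ℕ) * ((F.L : ℝ)⁻¹) ^ (K - n))⁻¹ * t) := fun c => by
    simp only [hXr]; split_ifs with h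
    · rw [abs_of_nonneg h, mul_comm]
    · rw [abs_of_neg (not_le.mp h)]; ring
  have hsum : H₀ Xr b = ∑ c, |Kc c| * (((F.L : ℝ) ^ (c.1.1 : ℕ) * ((F.L : ℝ)⁻¹) ^ (K - n))⁻¹ * t) := by
    rw [apply_eq_sum_kernel F K D H₀ Xr b]
    exact Finset.sum_congr rfl fun c _ => hKX c
  have h1 : ‖∑ c, (H₀ (Pi.single c 1) b * ((F.L : ℝ) ^ (c.1.1 : ℕ) * ((F.L : ℝ)⁻¹) ^ (K - n))⁻¹) • X c‖ ≤
      ∑ c, |Kc c| * (((F.L : ℝ) ^ (c.1.1 : ℕ) * ((F.L : ℝ)⁻¹) ^ (K - n))⁻¹ * t) := by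
    refine (norm_sum_le _ _).trans (Finset.sum_le_sum fun c _ => ?_)
    rw [norm_smul, Real.norm_eq_abs, abs_mul, abs_of_pos (inv_pos.2 (hlam c)), mul_assoc]
    exact mul_le_mul_of_nonneg_left (mul_le_mul_of_nonneg_left (hX c) (inv_nonneg.2 (hlam c).le)) (abs_nonneg _)
  calc w 1 b * ‖∑ c, (H₀ (Pi.single c 1) b * ((F.L : ℝ) ^ (c.1.1 : ℕ) * ((F.L : ℝ)⁻¹) ^ (K - n))⁻¹) • X c‖
      ≤ w 1 b * ∑ c, |Kc c| * (((F.L : ℝ) ^ (c.1.1 : ℕ) * ((F.L : ℝ)⁻¹) ^ (K - n))⁻¹ * t) := mul_le_mul_of_nonneg_left h1 (hw1 b)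
    _ = w 1 b * H₀ Xr b := by rw [hsum]
    _ ≤ w 1 b * |H₀ Xr b| := mul_le_mul_of_nonneg_left (le_abs_self _) (hw1 b)
    _ ≤ B₀ * t := (hsup Xr t ht hXr_w).1 b

/-- **THE GRADIENT ROW OF THE SCALED KERNEL EXTENSION** (guarded): `w 2 b·L^{K−n}·‖Σ_c ((H₀ e_c)(b+e_ν)·λ_c⁻¹)•X c − Σ_c ((H₀ e_c)(b)·λ_c⁻¹)•X c‖ ≤ B₀·t`,
`λ_c = L^{j(c)}η`, from `HSupLetterG`'s second row on the scaled sign data of the kernel difference. [cite: Balaban1985Variational, (46) p.285] -/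
theorem gradRow_scaledKernel (w : ℕ → PBond (F.P K) 0 → ℝ) (hw2 : ∀ b, 0 ≤ w 2 b) (H₀ : (BondIdx D → ℝ) →ₗ[ℝ] (PBond (F.P K) 0 → ℝ))
    {B₀ : ℝ} (hsup : HSupLetterG F n K D w H₀ B₀) (X : BondIdx D → Matrix (Fin 2) (Fin 2) ℂ) {t : ℝ} (ht : 0 ≤ t) (hX : ∀ c, ‖X c‖ ≤ t)
    (b : PBond (F.P K) 0) (ν : Fin 3) :
    w 2 b * (F.L : ℝ) ^ (K - n) *
      ‖(∑ c, (H₀ (Pi.single c 1) ⟨b.src.shift ν, b.dir⟩ * ((F.L : ℝ) ^ (c.1.1 : ℕ) * ((F.L : ℝ)⁻¹) ^ (K - n))⁻¹) • X c) -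
        ∑ c, (H₀ (Pi.single c 1) b * ((F.L : ℝ) ^ (c.1.1 : ℕ) * ((F.L : ℝ)⁻¹) ^ (K - n))⁻¹) • X c‖ ≤ B₀ * t := by
  classical
  have hL0 : (0 : ℝ) < F.L := by exact_mod_cast (F.P K).L_pos
  have hlam : ∀ c : BondIdx D, 0 < (F.L : ℝ) ^ (c.1.1 : ℕ) * ((F.L : ℝ)⁻¹) ^ (K - n) := fun c => by positivity
  set b' : PBond (F.P K) 0 := ⟨b.src.shift ν, b.dir⟩ with hb'
  set Kc : BondIdx D → ℝ := fun c => H₀ (Pi.single c 1) b' - H₀ (Pi.single c 1) b with hKc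
  set Xr : BondIdx D → ℝ := fun c => if 0 ≤ Kc c then ((F.L : ℝ) ^ (c.1.1 : ℕ) * ((F.L : ℝ)⁻¹) ^ (K - n))⁻¹ * t
    else -(((F.L : ℝ) ^ (c.1.1 : ℕ) * ((F.L : ℝ)⁻¹) ^ (K - n))⁻¹ * t) with hXr
  have hXr_abs : ∀ c, |Xr c| = ((F.L : ℝ) ^ (c.1.1 : ℕ) * ((F.L : ℝ)⁻¹) ^ (K - n))⁻¹ * t := fun c => by
    have h0 : 0 ≤ ((F.L : ℝ) ^ (c.1.1 : ℕ) * ((F.L : ℝ)⁻¹) ^ (K - n))⁻¹ * t := mul_nonneg (inv_nonneg.2 (hlam c).le) ht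
    simp only [hXr]; split_ifs
    · exact abs_of_nonneg h0
    · rw [abs_neg, abs_of_nonneg h0]
  have hXr_w : ∀ c, ((F.L : ℝ) ^ (c.1.1 : ℕ) * ((F.L : ℝ)⁻¹) ^ (K - n)) * |Xr c| ≤ t := fun c => by
    rw [hXr_abs, ← mul_assoc, mul_inv_cancel₀ (hlam c).ne', one_mul]
  have hKX : ∀ c, Xr c * Kc c = |Kc c| * (((F.L : ℝ) ^ (c.1.1 : ℕ) * ((F.L : ℝ)⁻¹) ^ (K - n))⁻¹ * t) := fun c => by
    simp only [hXr]; split_ifs with h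
    · rw [abs_of_nonneg h, mul_comm]
    · rw [abs_of_neg (not_le.mp h)]; ring
  have hsum : H₀ Xr b' - H₀ Xr b = ∑ c, |Kc c| * (((F.L : ℝ) ^ (c.1.1 : ℕ) * ((F.L : ℝ)⁻¹) ^ (K - n))⁻¹ * t) := by
    rw [apply_eq_sum_kernel F K D H₀ Xr b', apply_eq_sum_kernel F K D H₀ Xr b, ← Finset.sum_sub_distrib]
    refine Finset.sum_congr rfl fun c _ => ?_
    rw [← mul_sub]; exact hKX c
  have hdiff : (∑ c, (H₀ (Pi.single c 1) b' * ((F.L : ℝ) ^ (c.1.1 : ℕ) * ((F.L : ℝ)⁻¹) ^ (K - n))⁻¹) • X c) -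
      ∑ c, (H₀ (Pi.single c 1) b * ((F.L : ℝ) ^ (c.1.1 : ℕ) * ((F.L : ℝ)⁻¹) ^ (K - n))⁻¹) • X c =
      ∑ c, (Kc c * ((F.L : ℝ) ^ (c.1.1 : ℕ) * ((F.L : ℝ)⁻¹) ^ (K - n))⁻¹) • X c := by
    rw [← Finset.sum_sub_distrib]
    refine Finset.sum_congr rfl fun c _ => ?_
    rw [← sub_smul, ← sub_mul]
  have h1 : ‖(∑ c, (H₀ (Pi.single c 1) b' * ((F.L : ℝ) ^ (c.1.1 : ℕ) * ((F.L : ℝ)⁻¹) ^ (K - n))⁻¹) • X c) -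
      ∑ c, (H₀ (Pi.single c 1) b * ((F.L : ℝ) ^ (c.1.1 : ℕ) * ((F.L : ℝ)⁻¹) ^ (K - n))⁻¹) • X c‖ ≤
      ∑ c, |Kc c| * (((F.L : ℝ) ^ (c.1.1 : ℕ) * ((F.L : ℝ)⁻¹) ^ (K - n))⁻¹ * t) := by
    rw [hdiff]
    refine (norm_sum_le _ _).trans (Finset.sum_le_sum fun c _ => ?_)
    rw [norm_smul, Real.norm_eq_abs, abs_mul, abs_of_pos (inv_pos.2 (hlam c)), mul_assoc]
    exact mul_le_mul_of_nonneg_left (mul_le_mul_of_nonneg_left (hX c) (inv_nonneg.2 (hlam c).le)) (abs_nonneg _)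
  have hw0 : 0 ≤ w 2 b * (F.L : ℝ) ^ (K - n) := mul_nonneg (hw2 b) (by positivity)
  calc w 2 b * (F.L : ℝ) ^ (K - n) * ‖(∑ c, (H₀ (Pi.single c 1) b' * ((F.L : ℝ) ^ (c.1.1 : ℕ) * ((F.L : ℝ)⁻¹) ^ (K - n))⁻¹) • X c) -
        ∑ c, (H₀ (Pi.single c 1) b * ((F.L : ℝ) ^ (c.1.1 : ℕ) * ((F.L : ℝ)⁻¹) ^ (K - n))⁻¹) • X c‖
      ≤ w 2 b * (F.L : ℝ) ^ (K - n) * ∑ c, |Kc c| * (((F.L : ℝ) ^ (c.1.1 : ℕ) * ((F.L : ℝ)⁻¹) ^ (K - n))⁻¹ * t) := mul_le_mul_of_nonneg_left h1 hw0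
    _ = w 2 b * (F.L : ℝ) ^ (K - n) * (H₀ Xr b' - H₀ Xr b) := by rw [hsum]
    _ ≤ w 2 b * (F.L : ℝ) ^ (K - n) * |H₀ Xr b' - H₀ Xr b| := mul_le_mul_of_nonneg_left (le_abs_self _) hw0
    _ ≤ B₀ * t := (hsup Xr t ht hXr_w).2 b ν

/-! ## §3 The scaled extension of `flatH` as a ℂ-linear map: right inverse of `η·Lʲ·Q_j`, both rows, unguarded -/

/-- **THE LEVEL-SCALED ℂ-LINEAR EXTENSION OF P2's `flatH`** (see the module docstring): for every member, heights, EVERY nested family `D` and level weights,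
a ℂ-linear `Hs` with `Hs X b = Σ_c ((flatH e_c)(b)·(L^{j(c)}η)⁻¹) • X c`, the right-inverse identity `(L^{j(c)}η) • Q_{j(c)}(Hs X)(c) = X c` ((45)), and the two (46) rows
`w 1 b·‖Hs X b‖ ≤ B₀·t`, `w 2 b·L^{K−n}·‖Hs X (b+e_ν) − Hs X b‖ ≤ B₀·t` for `‖X c‖ ≤ t` (no guard), `B₀` = P2's `HSupLetterG` constant.
[cite: Balaban1985Variational, (44)-(46) p.285, (157) p.302; Balaban1984PropagatorsII, (2.20) p.226, (2.35) p.228] -/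
theorem exists_flatH_scaledExt (w : ℕ → PBond (F.P K) 0 → ℝ) (hw : IsLevWeight F n K D w) {B₀ : ℝ}
    (hsup : HSupLetterG F n K D w (flatH F n K D) B₀) :
    ∃ Hs : (BondIdx D → Matrix (Fin 2) (Fin 2) ℂ) →ₗ[ℂ] (PBond (F.P K) 0 → Matrix (Fin 2) (Fin 2) ℂ),
      (∀ X b, Hs X b = ∑ c, (flatH F n K D (Pi.single c 1) b * ((F.L : ℝ) ^ (c.1.1 : ℕ) * ((F.L : ℝ)⁻¹) ^ (K - n))⁻¹) • X c) ∧
      (∀ X (c : BondIdx D), ((F.L : ℝ) ^ (c.1.1 : ℕ) * ((F.L : ℝ)⁻¹) ^ (K - n)) • bondAvgIter (c.1.1 : ℕ) (Hs X) c.1.2 = X c) ∧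
      (∀ (X : BondIdx D → Matrix (Fin 2) (Fin 2) ℂ) (t : ℝ), (∀ c, ‖X c‖ ≤ t) → ∀ b, w 1 b * ‖Hs X b‖ ≤ B₀ * t) ∧
      ∀ (X : BondIdx D → Matrix (Fin 2) (Fin 2) ℂ) (t : ℝ), (∀ c, ‖X c‖ ≤ t) → ∀ (b : PBond (F.P K) 0) (ν : Fin 3),
        w 2 b * (F.L : ℝ) ^ (K - n) * ‖Hs X ⟨b.src.shift ν, b.dir⟩ - Hs X b‖ ≤ B₀ * t := by
  classical
  have hL0 : (0 : ℝ) < F.L := by exact_mod_cast (F.P K).L_pos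
  have hlam : ∀ c : BondIdx D, 0 < (F.L : ℝ) ^ (c.1.1 : ℕ) * ((F.L : ℝ)⁻¹) ^ (K - n) := fun c => by positivity
  obtain ⟨c₀⟩ := B9Thm39ReadingCoords.bondIdx_nonempty D
  -- the real kernel with the level factor
  set Ks : PBond (F.P K) 0 → BondIdx D → ℝ := fun b c => flatH F n K D (Pi.single c 1) b * ((F.L : ℝ) ^ (c.1.1 : ℕ) * ((F.L : ℝ)⁻¹) ^ (K - n))⁻¹
    with hKs
  let Hs : (BondIdx D → Matrix (Fin 2) (Fin 2) ℂ) →ₗ[ℂ] (PBond (F.P K) 0 → Matrix (Fin 2) (Fin 2) ℂ) :=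
    { toFun := fun X b => ∑ c, Ks b c • X c
      map_add' := fun X X' => funext fun b => by simp only [Pi.add_apply, smul_add, Finset.sum_add_distrib]
      map_smul' := fun a X => funext fun b => by simp only [Pi.smul_apply, smul_comm (Ks b _) a, Finset.smul_sum, RingHom.id_apply] }
  have hHs : ∀ X b, Hs X b = ∑ c, Ks b c • X c := fun _ _ => rfl
  refine ⟨Hs, fun X b => rfl, fun X c => ?_, fun X t hX b => ?_, fun X t hX b ν => ?_⟩
  · -- (45): `Q_j` passes through the real kernel, `Q_j(flatH e_c') = e_c'` on the index bonds
    have hfun : Hs X = fun b => ∑ c', Ks b c' • X c' := funext (hHs X)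
    rw [hfun, bondAvgIter_kernel_apply Ks X (c.1.1 : ℕ) c.1.2, Finset.smul_sum]
    have hker : ∀ c' : BondIdx D, bondAvgIter (c.1.1 : ℕ) (fun b => Ks b c') c.1.2 =
        ((F.L : ℝ) ^ (c'.1.1 : ℕ) * ((F.L : ℝ)⁻¹) ^ (K - n))⁻¹ * (Pi.single c' (1 : ℝ) : BondIdx D → ℝ) c := by
      intro c'
      have hsc : (fun b => Ks b c') =
          flatH F n K D ((((F.L : ℝ) ^ (c'.1.1 : ℕ) * ((F.L : ℝ)⁻¹) ^ (K - n))⁻¹) • (Pi.single c' (1 : ℝ) : BondIdx D → ℝ)) := by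
        funext b; simp only [hKs, map_smul, Pi.smul_apply, smul_eq_mul]; ring
      rw [hsc, bondAvgIter_of_isFlatH F n K D (flatH F n K D) (isFlatH_flatH F n K D) _ c, Pi.smul_apply, smul_eq_mul]
    simp_rw [hker]
    rw [Finset.sum_eq_single c (fun c' _ hc' => by rw [Pi.single_eq_of_ne (Ne.symm hc'), mul_zero, zero_smul, smul_zero])
      (fun h => absurd (Finset.mem_univ c) h), Pi.single_eq_same, mul_one, smul_smul, mul_inv_cancel₀ (hlam c).ne', one_smul]
  · exact supRow_scaledKernel F n K D w (fun b => levWeight_nonneg hw 1 b) (flatH F n K D) hsup X ((norm_nonneg _).trans (hX c₀)) hX b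
  · exact gradRow_scaledKernel F n K D w (fun b => levWeight_nonneg hw 2 b) (flatH F n K D) hsup X ((norm_nonneg _).trans (hX c₀)) hX b ν

end Summit.QuantumFields.YangMills.Theorems.FlatHDressingShape

end
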